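import Summits.BirchSwinnertonDyer.BirchSwinnertonDyer.Theorems.ErratumRoadFiveBstwDoorValuationIneqR
import Summits.BirchSwinnertonDyer.BirchSwinnertonDyer.Theorems.ErratumRoadFiveBdvCalibrationSplitNF
import Summits.BirchSwinnertonDyer.BirchSwinnertonDyer.Theorems.ErratumRoadFiveBdvCalibrationSplitNFCalibratorSupply
import HarnessLib

/-!
# REGISTRY r4 (pen bsd-stepL-plan g53, 2026-08-31) — line `bstw_door` of route ER5's aside item stmt-BirchSwinnertonDyer-33169
`Theses.ErratumRoadFive.KatoValuationIneqNonsplitAtFive`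

**r4 = r3 (commit bb71a3358f0d, sha16 24679077dd891ca9, 138 l.) re-keyed on the S2a-NF PRINT REDUCTION, director-bsd (778) 2026-08-31T08:11:07Z
«(σ1): GO now, in the (760)/(765) shape», BY IMPORT of ONE more built module.**  What changed and why (record): bsd-idea-9 g55 (complete lens)
typed and kernel-checked, in the UNBUILT workfile `Cruxes/EulerHalfNotRamNoInertSetAtFive/Lines/calibrator_Firr_Sketch.lean` rev 1.2
(commit 7c07f6162afa, sha16 c83736268e5f3766, 763 l., 0 sorry), that r3's S2a-NF stub `stub_calibratorSupplyNF` — the `P`-free CM-newform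
calibrator supply `∀ p ≥ 5 … CalibratorSupplyNF L p` — FOLLOWS from THREE NAMED PRINT FACTS of the Literature tree: Hida 2000 Thm. 3.26 (2)
(`Hida2000_thm326_ordinary_unitRoot`: ordinary ⇒ unit-root Frobenius eigenvalue), Deligne–Serre 1974 Thm. 6.1 (`DeligneSerre1974.thm61_exists_adicGaloisRep`:
Deligne's λ-adic representation attached to a newform) and the typer's PRE-fact `BurungaleSkinnerTianWan2024.prop523proof_appB_exists_orientedCMNewform_PRE`
(BSTW24 proof of Prop. 5.23 with App. B Lemma B.2: an oriented CM newform with the auxiliary characters at every admissible `(L, p)`; p801618);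
TY-SNF gap #4 (residual absolute irreducibility of the calibrator's representation, `F-irr`) is PROVED there from the CM clause (PART A–C),
`ρ` is CONSTRUCTED and Ribet's Thm. 2.3 input discharged in the tree (PART D), and PART E assembles all eight conjuncts.  The summoned prover
er5-p1 g21 PORTED PART A–E 1:1 into the BUILT modules `Theorems/ErratumRoadFiveBdvCalibrationSplitNFCalibratorSupply{Firr,CM,}.lean`
(p818837 ∕ p818911 ∕ p819002 ACCEPTED 2026-08-31T09:35–09:39Z, commits 25310bbcbd76 ∕ 88ed35993b86 ∕ abbc5f269827, module of record sha16
b43419ccdbacbfd4; critic bind-probe 557ee07001c74707 rc 0; the referee's LANDING RECORD on p818837 ∕ p818911 ∕ p819002 under HOME `referee/` gates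
this write and is named in the pen's GO line and in TARGET.md): `calibratorSupplyNF_of_printedFacts (hW) (h61) (hPRE) : <r3's stub_calibratorSupplyNF, token for token>`.
Hence, exactly as 24801 rev 10 did for (MO1) ⟸ (MO1ᴾ): **`stub_calibratorSupplyNF` is DELETED as a stub and DERIVED below
(`calibratorSupplyNF_of_print`) from three ONE-conjunct CITE stubs** `stub_hidaOrdinaryUnitRootPrint` · `stub_deligneSerrePrint` ·
`stub_bstwCMNewformSupplyPrint` (cite-only, HELD print; S0′ `stub_printedFactsHeldNonsplit` does NOT grow — (764)(A)(i): one print fact per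
by-name handle); `stub_printedFactsHeldNonsplit` (S0′) and `stub_portPiecesNFR` (THE research stub) are TOKEN-IDENTICAL to r3; the entry point
`KatoValuationIneqNonsplitAtFive_of` is the ONLY theorem concluding the item decl and is hypothesis-free (rev-10.1 layer discipline).
Stubs 3 → 5 (research 2 → 1: provers are served `stub_portPiecesNFR` alone + four cite stubs).  Wall-lead footnote (verbatim, (778)):
«33169 r4: (S2a-NF) ⟸ (Hida 3.26) ∧ (DS 6.1) ∧ (BSTW-PRE) in kernel; stubs 3 → 5; NOT progress».  D-0026 print inputs of this lineage
+2 by name (Hida326, BSTW-PRE; DS 6.1 already booked on 24801).  Route ER5's `closes` ∕ rev untouched; 33168 (aside twin) untouched;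
no census number moves (T7); registering ≠ proving; BSD is proved for no curve.

# REGISTRY r3 (pen bsd-stepL-plan g52, 2026-08-31) — kept verbatim below as the record of r3 — line `bstw_door` of route ER5's aside item stmt-BirchSwinnertonDyer-33169
`Theses.ErratumRoadFive.KatoValuationIneqNonsplitAtFive`

**r3 = r2 (commit of 2026-08-30T18:26:05Z, sha16 a6e65636170da625, 1650 l.) re-keyed on the T0′ SETTLEMENT and the NF calibrator
supply, BY IMPORT of built modules only.**  What changed and why (record): the typer's brief T0 (f-blindness of BDV22's scalar) was
re-read first-hand under SUMMON `t0prime` (typer bsd-stepL-ty-snf g1, memo `pub/bsd-stepL/ty-snf/g1/T0PRIME-MEMO.md` e1fb489bcfeca97b):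
`T0′: (P-T0)′ CONFIRMED` — BDV22's unit `A` carries the Petersson norm on `Γ₁(N_f)` (KLZ17 Thm. 2.7.4; LZ16 Thm. 9.3.2), while every
`f`-period object of the typed frame is a `Γ₀(N)`∕`X₀(N)` object (`plusPeriod`, `perRatio`, `congruenceNumber` (ARS), `modularDegree`),
so the index `ι_N = [Γ̄₀(N) : Γ̄₁(N)] = φ(N)/2` must be booked ONCE in the crossing exponent and r2's S1 `BdvChainExplicitNonsplit` booked
it ZERO times: S1 as typed is short by `ν(W) = v_p φ(N_W)` on `{W : p ∣ φ(N_W / p)}` and exact elsewhere (idea-9 memo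
`Cruxes/EulerHalfNotRamNoInertSetAtFive/Lines/bdv22_o4_erho_level.md` rev 1.4, erratum e9; referee `referee/REVERDICT-T0iota-g88.md`
02a0b0ea79cb63f4: RESOLVED on the merits).  Repair of record (pen decision 2026-08-31T03:03:23Z, option (α), TOTIENT spelling, zero new
notions): `bdvExplicitExponentR … N := bdvExplicitExponent … − v_p φ(N)` and the R-statements `BdvChainExplicitNonsplitR` ∕
`EisensteinPeriodRatioValuationR` ∕ `AFlatFamStatementR` (built module `Theorems/ErratumRoadFiveBdvCalibrationSplitRDefs`, er5-p1 g20,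
p806950), the R-glue (`…SplitR`, p807901) and the door's closed A♯ ∕ crossing ∕ valuation-inequality chain HOSTED in built modules
(`Theorems/ErratumRoadFiveBstwDoor{BdpFrameValue, CrossingR, ValuationIneqR}`, p807175 ∕ p808053 ∕ p808156; no-drift table
`pub/bsd-stepL/line-er5-p1/lead/g20/DECLDIFF-d2R-P1.md` d4740710431dcad8) — the sign check «C-sign» is KERNEL-CERTIFIED there: the
`−ν(W)` lands on the `ord_p t` side and the ν-FREE item text follows with slack `ν` (`famValuationIneqNonsplit_of_aFlatFamR`).  r2's S1
stub is thereby SUPERSEDED (a misstated-candidate by transcription, not refuted — no theorem), and r2's S2 (curve-calibrator supply at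
every admissible `(L, p)`, conjecture-shaped in print) is replaced by the NUMBER-FIELD ∕ CM-newform calibrator supply of BSTW24 (Prop. 4.23,
§8.2, Lemma 8.2 + Rohrlich 1984; typer facts p801618 `AuxiliaryNewformSupplyPRE` and p801874 `AuxiliaryHeckeCharactersAppendixBPRE`),
typed by idea-9's NF Sketch rev 1.2.1 (402b542340c4b640; critic idea-crit-14 V381 PASS) and PORTED 1:1 into the built module(s)
`Theorems/ErratumRoadFiveBdvCalibrationSplitNF{Defs, CalibratorDefs, }` (er5-p1 g20, p809716 `…SplitNFDefs` f9fd414a1352 · p809731 `…SplitNFCalibratorDefs` c8663012b5a0 · p810158 `…SplitNF` 6f9377d10572) — director-bsd (622)(b′) «S2-NF IS the line's S2» and (640)(1) «S2-NF becomes r3 when a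
built NF port exists».  The item text `KatoValuationIneqNonsplitAtFive` (ν-free valuation inequality, Néron∕optimal currency) is UNCHANGED;
route ER5's `closes` and rev are untouched by this act.

Shape (PIECES-on-R through the NF supply; r4: FIVE registered stubs (one research, four cite), ONE derived supply theorem, ONE by-name composition, nothing else):
* `stub_printedFactsHeldNonsplit` (S0′) — r2 text VERBATIM (nine refereed ∕ audited tree facts by name);
* r4: `stub_hidaOrdinaryUnitRootPrint` · `stub_deligneSerrePrint` · `stub_bstwCMNewformSupplyPrint` (three ONE-conjunct CITE stubs) and the
  DERIVED theorem `calibratorSupplyNF_of_print` (r3's S2a-NF `stub_calibratorSupplyNF` statement token for token, `P`-free, THEOREM-shaped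
  in print) — at every admissible `(L, p)`, `p ≥ 5`: `ErratumRoadFiveBdvCalibrationSplitNF.CalibratorSupplyNF L p`;
* `stub_portPiecesNFR` (S1R-NF ∧ S2c ∧ S2b-NF over ONE port `P`) — `∃ P : NFPort, BdvChainExplicitNFR P ∧ CalibratorDataRealisableNF P ∧
  BstwIntegralPerrinRiouNF P` (the research content: S1R = BDV22's chain in valuation currency with ONE shift uniform over the class, now
  with `ι_N` booked; the port fields pin BSTW24's literal normalisation `(a, b) = (0, 0)` and NAME the calibrator's Γ₁-congruence
  number `c̃_g` (`NFPort.IsCongruenceGenerator`, `NFCalibratorDatum.congrIdx`));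
* `KatoValuationIneqNonsplitAtFive_of` — the item BY NAME:
  `katoValuationIneqNonsplitAtFive_of_aFlatFamR stub_printedFactsHeldNonsplit (aFlatFamR_of_bdvCalibrationPiecesNFR ⟨S2a-NF derived, port⟩)`.
The two-stub MERGED road (`BdvCalibrationNFR`, glue `aFlatFamR_of_bdvCalibrationNFR`) and the curve-side R road
(`katoValuationIneqNonsplitAtFive_of_stubsR` ∕ `_of_piecesR`) are available in the same modules and are NOT registered here.

HONEST: registering ≠ proving; every stub below is `sorry`; nothing about any curve is proved by this file; BSD is proved for no curve. -/

set_option linter.unusedVariables false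
set_option linter.dupNamespace false

namespace Summit.BirchSwinnertonDyer.BirchSwinnertonDyer.Cruxes.KatoValuationIneqNonsplitAtFive.BstwDoor

open Field
open Literature.NumberTheory.GaloisRepresentations
open Literature.NumberTheory.EllipticCurves Literature.NumberTheory.EllipticCurves.Kato2004
open Literature.NumberTheory.EllipticCurves.Kato2004.EulerSystemValues
open Literature.NumberTheory.EllipticCurves.Rank1Residual
open Literature.NumberTheory.EllipticCurves.Rank1Residual.Typed
open Literature.NumberTheory.EllipticCurves.ModularForms
open Literature.NumberTheory.EllipticCurves.Castella2018
open Summit.BirchSwinnertonDyer.Rank1Residual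
open Summit.BirchSwinnertonDyer.BirchSwinnertonDyer.Theorems
open Summit.BirchSwinnertonDyer.BirchSwinnertonDyer.Theorems.ErratumRoadFiveBdvCalibrationSplit
open Summit.BirchSwinnertonDyer.BirchSwinnertonDyer.Theorems.ErratumRoadFiveBdvCalibrationSplitR
open Summit.BirchSwinnertonDyer.BirchSwinnertonDyer.Theorems.ErratumRoadFiveBdvCalibrationSplitNF
open Summit.BirchSwinnertonDyer.BirchSwinnertonDyer.Theorems.ErratumRoadFiveBstwDoor
open Summit.BirchSwinnertonDyer.BirchSwinnertonDyer.Theses.ErratumRoadFive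

/-- **S0′ — `stub_printedFactsHeldNonsplit` (r1∕r2 text VERBATIM; CITE-sized).**  Conjunction of nine refereed ∕ audited tree facts
BY NAME: modular parametrisations exist [BCDT01], Hoffstein–Luo non-vanishing twists, Gross–Zagier [GZ86 I.(6.5), V.§2],
Agashe–Ribet–Stein `m_f ∣ r_f` [ARS12 Thm. 2.1], Mazur's Manin-constant unit [Maz78 Cor. 4.1], the BDP value frame at one (thm32,
Castella 2018 Thms. 3.1–3.2), Castella's exceptional value continuity, Hsieh 2014 Thm. A (anticyclotomic p-adic L-function with unit
period) and BDP13 Thm. 5.5 (central-value reciprocity).  Each conjunct's `_holds` is a typer ∕ D-0026 debt, not research.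
[cite: BCDT2001, Thm. A] [cite: GrossZagier1986, I.(6.5) and V.§2] [cite: AgasheRibetStein2012, Thm. 2.1]
[cite: Mazur1978, Cor. 4.1] [cite: Castella2018, Thm. 3.1 and Thm. 3.2 with (3.2) (arXiv:1704.06608 p. 9)]
[cite: Castella2018Exceptional, Thms. 2.10–2.11 (arXiv:1507.04260 pp. 13–14)]
[cite: Hsieh2014, Thm. A (p. 712) and Thms. 5.6–5.7 (arXiv:1112.1580 pp. 3–4, 23)]
[cite: BertoliniDarmonPrasanna2013, Thm. 5.5 and (5.1.16) (p. 60)] -/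
theorem stub_printedFactsHeldNonsplit :
    nonempty_modularParametrizationData ∧ HoffsteinLuo1997_exists_twist_L_one_ne_zero ∧
      (∀ (N : ℕ) [NeZero N] (W : WeierstrassCurve ℚ) (L : Type) [Field L] [NumberField L], gross_zagier N W L) ∧
      modularDegree_dvd_congruenceNumber ∧ mazur_not_dvd_maninConstant_of_odd ∧
      thm32_exists_isBDPLFunction_valueAtOne ∧ castella2018Exceptional_bdpValueContinuity_trivialChar ∧
      hsieh2014_exists_anticyclotomicPAdicLFunction_unrPeriod ∧ bertoliniDarmonPrasanna2013_centralValue_reciprocity := by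
  sorry

/-- **(Hida 3.26) — `stub_hidaOrdinaryUnitRootPrint` (CITE stub, one conjunct; r4).**  Hida 2000 Thm. 3.26 (2): a `p`-ordinary
newform's `p`-adic Galois representation has a unit-root unramified quotient with Frobenius eigenvalue the unit root of the Hecke
polynomial — the Literature's named fact `Hida2000_thm326_ordinary_unitRoot` (HELD print; typer ∕ D-0026 debt, not research).
[cite: Hida2000, Thm. 3.26 (2), p. 152] -/
theorem stub_hidaOrdinaryUnitRootPrint : Literature.NumberTheory.EllipticCurves.Hida2000_thm326_ordinary_unitRoot := by
  sorry

/-- **(DS 6.1) — `stub_deligneSerrePrint` (CITE stub, one conjunct; r4).**  Deligne's theorem as quoted in Deligne–Serre 1974 Thm. 6.1: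
the `λ`-adic Galois representation attached to a weight-`k ≥ 2` newform exists with the Eichler–Shimura trace relation — the Literature's
named fact `DeligneSerre1974.thm61_exists_adicGaloisRep` (HELD print; the same by-name input as 24801's `stub_galoisTransferInputs` left
conjunct; typer ∕ D-0026 debt, not research).
[cite: DeligneSerreASENS1974, Thm. 6.1] -/
theorem stub_deligneSerrePrint : Literature.NumberTheory.EllipticCurves.ModularForms.DeligneSerre1974.thm61_exists_adicGaloisRep := by
  sorry

/-- **(BSTW-PRE) — `stub_bstwCMNewformSupplyPrint` (CITE stub, one conjunct; r4).**  BSTW24, proof of Prop. 5.23 with App. B Lemma B.2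
and §7.2: at every admissible `(L, p)` (`p ≠ 2`, `L` imaginary quadratic Heegner at `p`, `d_L ∉ {−4, −8}`) an oriented CM newform `g` of
level prime to `p`, `p`-ordinary, Heegner for `L`, of analytic rank one over `L`, with the auxiliary Hecke characters — the typer's PRE
fact `BurungaleSkinnerTianWan2024.prop523proof_appB_exists_orientedCMNewform_PRE` (p801618 `AuxiliaryNewformSupplyPRE`; HELD print;
typer ∕ D-0026 debt, not research).
[cite: BurungaleSkinnerTianWan2024, proof of Prop. 5.23 with App. B Lemma B.2 and §7.2] -/
theorem stub_bstwCMNewformSupplyPrint :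
    Literature.NumberTheory.EllipticCurves.BurungaleSkinnerTianWan2024.prop523proof_appB_exists_orientedCMNewform_PRE := by
  sorry


/-- **S1R-NF ∧ S2c ∧ S2b-NF over ONE port — `stub_portPiecesNFR` (the RESEARCH stub; XL).**  There is ONE number-field port
`P : NFPort` (BSTW24's two-variable zeta element ∕ Perrin-Riou big logarithm over the CM field, with its literal normalisation pinned:
value functional in `ω_g`-coordinates (`a = 0`), Bloch–Kato logarithm along `η_{ω_g}` (`b = 0`), the class generated against the
calibrator's `Γ₁(N_g)`-congruence number `c̃_g` — `NFPort.IsCongruenceGenerator`) such that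
(i) S1R-NF `BdvChainExplicitNFR P`: BDV22's explicit-reciprocity chain [Thm. 3.1 (14), §4.1 (32), Thm. 4.2, Lemma 4.6] in valuation
currency with ONE shift `V : ℕ → ℤ → ℤ` uniform over the non-exceptional rank-one class, the target leg reading the REPAIRED exponent
`bdvExplicitExponentR … N = bdvExplicitExponent … − v_p φ(N)` (the `Γ₁(N_f)`-Petersson index of KLZ17 Thm. 2.7.4 booked once; T0′),
and the calibrator leg its NF conjunct; (ii) S2c `CalibratorDataRealisableNF P`: every supplied calibrator carries a full datum with
`X ≠ 0`; (iii) S2b-NF `BstwIntegralPerrinRiouNF P`: on every datum BSTW24's integral Perrin-Riou identity holds EXACTLY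
(`‖D.X‖ = D.rhs`, Thm. 6.4 with §6.2.1 (86)–(94), `u_L ∈ ℤ_(p)^×`).  Why it might fail: (i) is research — BDV prove (38) «up to an
explicit non-zero scalar in K(a_n(f_α))» (p. 44 L19–21) and no integral Thm. 3.1 is in print at a `p`-new point; the uniformity of
`V` in the member is the content (critic V361 C1), now with the one known member-dependent factor `ι_N` booked; (ii)–(iii) are a PORT
of printed statements whose Lean carriers (`NFPort`, `NFCalibratorDatum`) posit two fields.  Bundled `∃ P` with S1R-NF on purpose
(critic P-NF1 polarity: over the junk port (ii)–(iii) are vacuous, (i) is not).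
[cite: BertoliniDarmonVenerucci2022, Thm. 3.1 (14), §4.1 (32), Thm. 4.2, Lemma 4.6 (pp. 44–45)]
[cite: KingsLoefflerZerbes2017, Thm. 2.7.4] [cite: BurungaleSkinnerTianWan2024, Thm. 6.4 (p. 59), §6.2.1 (p. 60), Lemma 1.5, Rem. 1.7 (p. 15)]
[cite: Kato2004Asterisque, Thm. 12.5 (1) (pp. 221–222), Lemma 13.10 (1) (p. 230)] [cite: KobayashiOta2022, a_p = −1 at non-split multiplicative p] -/
theorem stub_portPiecesNFR :
    ∃ P : NFPort, BdvChainExplicitNFR P ∧ CalibratorDataRealisableNF P ∧ BstwIntegralPerrinRiouNF P := by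
  sorry

/-- **S2a-NF DERIVED (r4) — `calibratorSupplyNF_of_print`: r3's `stub_calibratorSupplyNF` statement TOKEN FOR TOKEN, now a one-line
consequence of the three cite stubs via the ported `calibratorSupplyNF_of_printedFacts` (bsd-idea-9 g55 PART A–E; er5-p1 g21 port p819002).**
r3's docstring of record follows.  (`P`-FREE supply; THEOREM-shaped in print; road (b′) of director-bsd (622).)  At every
admissible `(L, p)` — `p ≥ 5`, `L` imaginary quadratic, Heegner at `p`, `d_L < −4` odd — there is a good-ordinary weight-2 newform
`g` of some level `N` prime to `2p` with residually absolutely irreducible big-image Galois representation, `p`-unit `a_p(g)`,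
Heegner for `L` at `N`, analytic rank one over `L` with the BDP sign, together with the auxiliary Hecke characters of BSTW24 App. B:
`ErratumRoadFiveBdvCalibrationSplitNF.CalibratorSupplyNF L p`.  Why plausibly true: BSTW24 Prop. 4.23 ∕ §8.2 𝔛 ∕ Lemma 8.2 supply CM
newforms with the required local behaviour and App. B the characters (typer facts `AuxiliaryNewformSupplyPRE` p801618 and
`AuxiliaryHeckeCharactersAppendixBPRE` p801874, gap table 6∕8 of `pub/bsd-stepL/ty-snf/g0/TY-SNF-MEMO.md`: open rows = residual
irreducibility of `Ind ψ̄` in the needed form (#4) and the analytic-rank-one clause via Rohrlich–Jia (tree fact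
`RohrlichJia_centralOrder_anticyclotomicTwists`)).  Why it might fail: the conjunction asks ALL clauses at EVERY admissible `(L, p)`;
the printed supply is per-`(L, p)` with finitely many exceptions not yet matched to `d_L < −4` odd.  Size: SUPPLY (L), print-fed.
[cite: BurungaleSkinnerTianWan2024, Prop. 4.23 (p. 45), §8.2 and Lemma 8.2 (pp. 66–67), App. B Lemma B.2]
[cite: Rohrlich1984, p. 551] -/
theorem calibratorSupplyNF_of_print :
    ∀ (p : ℕ) [Fact p.Prime], 5 ≤ p → ∀ (L : Type) [Field L] [NumberField L],
      IsImaginaryQuadratic L → SatisfiesHeegnerHypothesis p L → NumberField.discr L < -4 →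
      Odd (NumberField.discr L) → ErratumRoadFiveBdvCalibrationSplitNF.CalibratorSupplyNF L p :=
  ErratumRoadFiveBdvCalibrationSplitNFCalibratorSupply.calibratorSupplyNF_of_printedFacts
    stub_hidaOrdinaryUnitRootPrint stub_deligneSerrePrint stub_bstwCMNewformSupplyPrint

/-- **A♭-famR is a THEOREM of S2a-NF ∧ the port stub** by the landed NF glue `aFlatFamR_of_bdvCalibrationPiecesNFR` (er5-p1 g20's
1:1 port of idea-9's NF Sketch rev 1.2.1; sorry-free modulo the stubs, consumed BY NAME); r4: S2a-NF enters DERIVED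
(`calibratorSupplyNF_of_print`), the port stub as before. -/
theorem aFlatFamR_of_calibrationStubs : AFlatFamStatementR :=
  aFlatFamR_of_bdvCalibrationPiecesNFR ⟨calibratorSupplyNF_of_print, stub_portPiecesNFR⟩

/-- **REGISTRY ENTRY POINT (pen g53, r4; r3 text with the stub list updated)** — item stmt-BirchSwinnertonDyer-33169
`Theses.ErratumRoadFive.KatoValuationIneqNonsplitAtFive` concluded BY NAME from the FIVE registered stubs `stub_printedFactsHeldNonsplit` (S0′),
`stub_hidaOrdinaryUnitRootPrint` · `stub_deligneSerrePrint` · `stub_bstwCMNewformSupplyPrint` (cite; S2a-NF derived from them) and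
`stub_portPiecesNFR` (S1R-NF ∧ S2c ∧ S2b-NF), via the hosted door chain's entry `katoValuationIneqNonsplitAtFive_of_aFlatFamR`
(`Theorems/ErratumRoadFiveBstwDoorValuationIneqR`, p808156; C-sign kernel-certified). Proves nothing unconditionally. -/
theorem KatoValuationIneqNonsplitAtFive_of :
    Summit.BirchSwinnertonDyer.BirchSwinnertonDyer.Theses.ErratumRoadFive.KatoValuationIneqNonsplitAtFive :=
  katoValuationIneqNonsplitAtFive_of_aFlatFamR stub_printedFactsHeldNonsplit aFlatFamR_of_calibrationStubs

end Summit.BirchSwinnertonDyer.BirchSwinnertonDyer.Cruxes.KatoValuationIneqNonsplitAtFive.BstwDoor
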